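import Mathlib
import HarnessLib
import Summits.HubbardSuperconductivity.HubbardSuperconductivity.Theorems.KLProgrammeFreeBandRadiusDerivBoxesSound

/-!
# Route `KLProgramme` — ENGINE crux `KLRegimeEngineV17F2` (stmt-HubbardSuperconductivity-20437), row (C) `hcertA : KlwjCertA`:
# the BRACKET part of the box checker as a reusable lemma (cell gate-hubbard-kl, seat p1b g19)

`R1Box.checkBr` = the bracket conjuncts of `R1Box.check` (cosine brackets from `cos² + sin² = 1`, the two certified level comparisons
`F(θ*, q1/10⁶) ≤ μ ≤ F(θ_*, q2/10⁶)` at the extreme angles of the box) WITHOUT the order-1 ratio test; **`R1Box.brackets`**: `checkBr = true →` on the box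
`q1 ≤ 10⁶·u_μ(θ) ≤ q2`, `c1 ≤ 10⁶ cos θ ≤ c2`, `10⁶ sin θ ≤ s2` — the input of every higher-entry certificate (`D1`, `G1`: `…FreeBandSlopeDerivBoxes`; orders ≥ 2:
k3c5-p1 lineage).  Proof = the argument of `abs_bandFermiRadiusDeriv_le_of_check` (`…BoxesSound`), exported.  Elementary; nothing about the Hubbard model
is asserted. [folklore]
-/

noncomputable section

namespace Summit.HubbardSuperconductivity.HubbardSuperconductivity.Theorems.PerturbedFermiCurve

set_option linter.dupNamespace false -- summit = problem name (single-conjunct summit), D-0017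

open Real Set Literature.MathematicalPhysics.QuantumLattice

/-- **The bracket checker** of a box (integer arithmetic): `R1Box.check r` minus its final order-1 ratio test. -/
def R1Box.checkBr (B : R1Box) : Bool :=
  decide (B.s1 ≤ B.s2) &&
  (if B.top then decide (2 * (B.c1 * B.c1) ≤ 10 ^ 12) && decide (10 ^ 12 ≤ 2 * (B.s2 * B.s2))
   else decide (B.c1 * B.c1 + B.s2 * B.s2 ≤ 10 ^ 12) && decide (10 ^ 12 ≤ B.chat * B.chat + B.s2 * B.s2) &&
     decide (2 * (B.s2 * B.s2) ≤ 10 ^ 12)) &&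
  decide (B.ccheck * B.ccheck + B.s1 * B.s1 ≤ 10 ^ 12) && decide (10 ^ 12 ≤ B.c2 * B.c2 + B.s1 * B.s1) &&
  decide (B.q2 * B.c2 ≤ 3141592000000) && decide (B.q2 * B.s2 ≤ 3141592000000) && decide (B.q1 ≤ 4000000) &&
  (if B.top then decide (-4 * fpCosLoTop (B.q1 * B.q1) * 10 ^ 6 ≤ B.m1 * (87178291200 * 128 * 10 ^ 84))
   else decide (B.q1 * B.chat ≤ 3141592000000) &&
     decide (-2 * (fpCosLo (B.q1 * B.chat) + fpCosLo (B.q1 * B.s2)) * 10 ^ 6 ≤ B.m1 * (87178291200 * 10 ^ 168))) &&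
  decide (B.m2 * (479001600 * 10 ^ 144) ≤ -2 * (fpCosHi (B.q2 * B.ccheck) + fpCosHi (B.q2 * B.s1)) * 10 ^ 6)

section Sound

variable {μ : ℝ} (hμ₁ : -4 < μ) (hμ₂ : μ < 0)
include hμ₁ hμ₂

set_option maxHeartbeats 800000 in
/-- **THE BRACKETS OF A CHECKED BOX.**  If `B.checkBr = true` then for every level `μ ∈ [m1, m2]/10⁶` (`-4 < μ < 0`) and every angle `θ ∈ [0, π/4]`
of the box: `q1 ≤ 10⁶ u_μ(θ) ≤ q2`, `c1 ≤ 10⁶ cos θ ≤ c2`, `10⁶ sin θ ≤ s2`. -/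
theorem R1Box.brackets {B : R1Box} (hB : B.checkBr = true)
    (hm1 : (B.m1 : ℝ) ≤ μ * 10 ^ 6) (hm2 : μ * 10 ^ 6 ≤ (B.m2 : ℝ)) {θ : ℝ} (hθ : θ ∈ Icc 0 (π / 4))
    (hs1 : (B.s1 : ℝ) ≤ Real.sin θ * 10 ^ 6) (hs2 : B.top = false → Real.sin θ * 10 ^ 6 ≤ (B.s2 : ℝ)) :
    ((B.q1 : ℝ) ≤ bandFermiRadius μ θ * 10 ^ 6 ∧ bandFermiRadius μ θ * 10 ^ 6 ≤ B.q2) ∧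
      ((B.c1 : ℝ) ≤ Real.cos θ * 10 ^ 6 ∧ Real.cos θ * 10 ^ 6 ≤ B.c2) ∧ Real.sin θ * 10 ^ 6 ≤ B.s2 := by
  have hπ1 := Real.pi_gt_d6
  have hπ2 := Real.pi_lt_d6
  obtain ⟨hsθ, hsc, hc⟩ := octant_trig hθ
  have hθ2 : θ ≤ π / 2 := by linarith [hθ.2, Real.pi_pos]
  have hcs : Real.cos θ ^ 2 + Real.sin θ ^ 2 = 1 := Real.cos_sq_add_sin_sq θ
  have hs_le : Real.sin θ ≤ Real.sqrt 2 / 2 := by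
    rw [← Real.sin_pi_div_four]
    exact Real.sin_le_sin_of_le_of_le_pi_div_two (by linarith [hθ.1]) (by linarith) hθ.2
  have hc_ge : Real.sqrt 2 / 2 ≤ Real.cos θ := by
    rw [← Real.cos_pi_div_four]
    exact Real.cos_le_cos_of_nonneg_of_le_pi hθ.1 (by linarith) hθ.2
  have hsq2 : (Real.sqrt 2 / 2) ^ 2 = 1 / 2 := by
    rw [div_pow, Real.sq_sqrt (by norm_num)]; norm_num
  have hsqlt := sqrt_two_div_two_lt
  have hu0 : 0 < bandFermiRadius μ θ := bandFermiRadius_pos hμ₁ hμ₂ θ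
  cases htop : B.top <;>
    simp only [R1Box.checkBr, htop, Bool.false_eq_true, ↓reduceIte, Bool.and_eq_true, decide_eq_true_eq,
      and_assoc] at hB
  · -- non-top box
    obtain ⟨h1, h2, h3, h4, h5, h6, h7, h8, h9, h10, h11, h12⟩ := hB
    have hs2' : Real.sin θ * 10 ^ 6 ≤ (B.s2 : ℝ) := hs2 htop
    have hc2r := cos_scaled_le_of_check h6 hθ hs1
    have hq2r := radius_le_of_check hμ₁ hμ₂ h5 h6 h7 h12 hm2 hθ hs1
    -- c1 ≤ 10⁶ cos θ
    have h2' : (B.c1 : ℝ) * B.c1 + (B.s2 : ℝ) * B.s2 ≤ 10 ^ 12 := by exact_mod_cast h2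
    have hc1r : (B.c1 : ℝ) ≤ Real.cos θ * 10 ^ 6 := by
      have hss := mul_le_mul hs2' hs2' (by positivity) (Nat.cast_nonneg _)
      have e : (Real.cos θ * 10 ^ 6) ^ 2 = 10 ^ 12 - Real.sin θ * 10 ^ 6 * (Real.sin θ * 10 ^ 6) := by
        linear_combination (10:ℝ) ^ 12 * hcs
      have h1 : (B.c1 : ℝ) ^ 2 ≤ (Real.cos θ * 10 ^ 6) ^ 2 := by rw [e, sq]; linarith
      exact (pow_le_pow_iff_left₀ (Nat.cast_nonneg _) (by positivity) two_ne_zero).1 h1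
    -- lower radius bracket from the top-angle comparison
    have h4' : 2 * ((B.s2 : ℝ) * B.s2) ≤ 10 ^ 12 := by exact_mod_cast h4
    have h3' : (10:ℝ) ^ 12 ≤ (B.chat : ℝ) * B.chat + (B.s2 : ℝ) * B.s2 := by exact_mod_cast h3
    have hσ0 : (0 : ℝ) ≤ (B.s2 : ℝ) / 10 ^ 6 := by positivity
    have eσ : ((B.s2 : ℝ) / 10 ^ 6) ^ 2 = (B.s2 : ℝ) * B.s2 / 10 ^ 12 := by ring
    have hσ2 : (B.s2 : ℝ) / 10 ^ 6 ≤ Real.sqrt 2 / 2 := by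
      have : ((B.s2 : ℝ) / 10 ^ 6) ^ 2 ≤ (Real.sqrt 2 / 2) ^ 2 := by
        rw [hsq2, eσ, div_le_iff₀ (by positivity)]; linarith
      exact (pow_le_pow_iff_left₀ hσ0 (by positivity) two_ne_zero).1 this
    have hσ1 : (B.s2 : ℝ) / 10 ^ 6 ≤ 1 := by linarith
    have hθ₁0 : 0 ≤ Real.arcsin ((B.s2 : ℝ) / 10 ^ 6) := Real.arcsin_nonneg.2 hσ0
    have hθ₁4 : Real.arcsin ((B.s2 : ℝ) / 10 ^ 6) ≤ π / 4 := by
      rw [Real.arcsin_le_iff_le_sin ⟨by linarith, hσ1⟩ ⟨by linarith [Real.pi_pos], by linarith [Real.pi_pos]⟩,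
        Real.sin_pi_div_four]
      exact hσ2
    have hθ₁mem : Real.arcsin ((B.s2 : ℝ) / 10 ^ 6) ∈ Icc 0 (π / 4) := ⟨hθ₁0, hθ₁4⟩
    have hθle : θ ≤ Real.arcsin ((B.s2 : ℝ) / 10 ^ 6) := le_arcsin_of_sin_le hθ.1 hθ2 (by linarith) hσ1
      (by rw [le_div_iff₀ (by norm_num : (0:ℝ) < 10 ^ 6)]; exact hs2')
    have hsin₁ : Real.sin (Real.arcsin ((B.s2 : ℝ) / 10 ^ 6)) = (B.s2 : ℝ) / 10 ^ 6 := Real.sin_arcsin (by linarith) hσ1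
    have hcos₁ : Real.cos (Real.arcsin ((B.s2 : ℝ) / 10 ^ 6)) = Real.sqrt (1 - ((B.s2 : ℝ) / 10 ^ 6) ^ 2) :=
      Real.cos_arcsin _
    have hanti : bandFermiRadius μ (Real.arcsin ((B.s2 : ℝ) / 10 ^ 6)) ≤ bandFermiRadius μ θ :=
      bandFermiRadius_antitoneOn_octant hμ₁ hμ₂ hθ hθ₁mem hθle
    obtain ⟨_, _, hc₁0⟩ := octant_trig hθ₁mem
    generalize hθ₁ : Real.arcsin ((B.s2 : ℝ) / 10 ^ 6) = θ₁ at hθ₁mem hsin₁ hcos₁ hanti hc₁0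
    have hchat : Real.cos θ₁ * 10 ^ 6 ≤ B.chat := by
      rw [hcos₁]
      have h1 : 1 - ((B.s2 : ℝ) / 10 ^ 6) ^ 2 ≤ ((B.chat : ℝ) / 10 ^ 6) ^ 2 := by
        have e1 : ((B.chat : ℝ) / 10 ^ 6) ^ 2 = (B.chat : ℝ) * B.chat / 10 ^ 12 := by ring
        have h3 : 1 ≤ (B.chat : ℝ) * B.chat / 10 ^ 12 + (B.s2 : ℝ) * B.s2 / 10 ^ 12 := by
          rw [← add_div, one_le_div (by positivity)]; exact h3'
        rw [e1, eσ]; linarith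
      have h2 : Real.sqrt (1 - ((B.s2 : ℝ) / 10 ^ 6) ^ 2) ≤ (B.chat : ℝ) / 10 ^ 6 := by
        rw [← Real.sqrt_sq (by positivity : (0:ℝ) ≤ (B.chat : ℝ) / 10 ^ 6)]
        exact Real.sqrt_le_sqrt h1
      rw [le_div_iff₀ (by norm_num : (0:ℝ) < 10 ^ 6)] at h2; exact h2
    have hq0 : (0 : ℝ) ≤ (B.q1 : ℝ) / 10 ^ 6 := by positivity
    have h10' : (B.q1 : ℝ) * B.chat ≤ 3141592000000 := by exact_mod_cast h10
    have hqcos : (B.q1 : ℝ) / 10 ^ 6 * Real.cos θ₁ ≤ 3.141592 := by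
      have h1 : (B.q1 : ℝ) * (Real.cos θ₁ * 10 ^ 6) ≤ (B.q1 : ℝ) * (B.chat : ℝ) :=
        mul_le_mul_of_nonneg_left hchat (Nat.cast_nonneg _)
      have e3 : (B.q1 : ℝ) / 10 ^ 6 * Real.cos θ₁ = (B.q1 : ℝ) * (Real.cos θ₁ * 10 ^ 6) / 10 ^ 12 := by ring
      rw [e3, div_le_iff₀ (by norm_num : (0:ℝ) < 10 ^ 12)]; linarith
    have hqπ : (B.q1 : ℝ) / 10 ^ 6 * ‖dir θ₁‖ ≤ π := by rw [norm_dir_of_mem_octant hθ₁mem]; linarith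
    have hcomp : rayDispersion (θ₁, (B.q1 : ℝ) / 10 ^ 6) ≤ μ := by
      rw [rayDispersion_eq]
      simp only [hsin₁]
      have hx0 : 0 ≤ (B.q1 : ℝ) / 10 ^ 6 * Real.cos θ₁ := by positivity
      have hxy : (B.q1 : ℝ) / 10 ^ 6 * Real.cos θ₁ ≤ ((B.q1 * B.chat : ℕ) : ℝ) / 10 ^ 12 := by
        rw [Nat.cast_mul, le_div_iff₀ (by norm_num : (0:ℝ) < 10 ^ 12)]
        have h1 : (B.q1 : ℝ) * (Real.cos θ₁ * 10 ^ 6) ≤ (B.q1 : ℝ) * (B.chat : ℝ) :=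
          mul_le_mul_of_nonneg_left hchat (Nat.cast_nonneg _)
        have e : (B.q1 : ℝ) / 10 ^ 6 * Real.cos θ₁ * 10 ^ 12 = (B.q1 : ℝ) * (Real.cos θ₁ * 10 ^ 6) := by ring
        rw [e]; exact h1
      have hyπ : ((B.q1 * B.chat : ℕ) : ℝ) / 10 ^ 12 ≤ π := by
        rw [Nat.cast_mul, div_le_iff₀ (by norm_num : (0:ℝ) < 10 ^ 12)]; linarith
      have hcos1 : Real.cos (((B.q1 * B.chat : ℕ) : ℝ) / 10 ^ 12) ≤ Real.cos ((B.q1 : ℝ) / 10 ^ 6 * Real.cos θ₁) :=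
        Real.cos_le_cos_of_nonneg_of_le_pi hx0 hyπ hxy
      have hT1 := fpCosLo_le (B.q1 * B.chat)
      have hT2 := fpCosLo_le (B.q1 * B.s2)
      have e2 : (B.q1 : ℝ) / 10 ^ 6 * ((B.s2 : ℝ) / 10 ^ 6) = ((B.q1 * B.s2 : ℕ) : ℝ) / 10 ^ 12 := by
        rw [Nat.cast_mul]; ring
      rw [e2]
      have h11' : -2 * (((fpCosLo (B.q1 * B.chat) : ℤ) : ℝ) + ((fpCosLo (B.q1 * B.s2) : ℤ) : ℝ)) * 10 ^ 6 ≤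
          (B.m1 : ℝ) * (87178291200 * 10 ^ 168) := by exact_mod_cast h11
      linarith only [hcos1, hT1, hT2, h11', hm1]
    have hge : (B.q1 : ℝ) / 10 ^ 6 ≤ bandFermiRadius μ θ₁ :=
      le_bandFermiRadius_of_rayDispersion_le hμ₁ hμ₂ hq0 hqπ hcomp
    have hq1r : (B.q1 : ℝ) ≤ bandFermiRadius μ θ * 10 ^ 6 := by
      rw [div_le_iff₀ (by norm_num : (0:ℝ) < 10 ^ 6)] at hge; linarith
    exact ⟨⟨hq1r, hq2r⟩, ⟨hc1r, hc2r⟩, hs2'⟩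
  · -- top box
    obtain ⟨h1, h2, h3, h5, h6, h7, h8, h9, h10, h12⟩ := hB
    have hc2r := cos_scaled_le_of_check h6 hθ hs1
    have hq2r := radius_le_of_check hμ₁ hμ₂ h5 h6 h7 h12 hm2 hθ hs1
    have h2' : 2 * ((B.c1 : ℝ) * B.c1) ≤ 10 ^ 12 := by exact_mod_cast h2
    have h3' : (10:ℝ) ^ 12 ≤ 2 * ((B.s2 : ℝ) * B.s2) := by exact_mod_cast h3
    have esq : Real.sqrt 2 / 2 * (Real.sqrt 2 / 2) = 1 / 2 := by rw [← sq, hsq2]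
    have hc1r : (B.c1 : ℝ) ≤ Real.cos θ * 10 ^ 6 := by
      have hcc := mul_le_mul hc_ge hc_ge (by positivity) hc.le
      rw [esq] at hcc
      have e : (Real.cos θ * 10 ^ 6) ^ 2 = Real.cos θ * Real.cos θ * 10 ^ 12 := by ring
      have h1 : (B.c1 : ℝ) ^ 2 ≤ (Real.cos θ * 10 ^ 6) ^ 2 := by rw [e, sq]; linarith
      exact (pow_le_pow_iff_left₀ (Nat.cast_nonneg _) (by positivity) two_ne_zero).1 h1
    have hs2' : Real.sin θ * 10 ^ 6 ≤ (B.s2 : ℝ) := by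
      have hss := mul_le_mul hs_le hs_le hsθ (by positivity)
      rw [esq] at hss
      have e : (Real.sin θ * 10 ^ 6) ^ 2 = Real.sin θ * Real.sin θ * 10 ^ 12 := by ring
      have h1 : (Real.sin θ * 10 ^ 6) ^ 2 ≤ (B.s2 : ℝ) ^ 2 := by rw [e, sq]; linarith
      exact (pow_le_pow_iff_left₀ (by positivity) (Nat.cast_nonneg _) two_ne_zero).1 h1
    -- lower radius bracket from the comparison at `π/4`
    have hanti : bandFermiRadius μ (π / 4) ≤ bandFermiRadius μ θ := bandFermiRadius_pi_div_four_le hμ₁ hμ₂ hθ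
    have hq0 : (0 : ℝ) ≤ (B.q1 : ℝ) / 10 ^ 6 := by positivity
    have h9' : (B.q1 : ℝ) ≤ 4000000 := by exact_mod_cast h9
    have hq4 : (B.q1 : ℝ) / 10 ^ 6 ≤ 4 := by rw [div_le_iff₀ (by norm_num : (0:ℝ) < 10 ^ 6)]; linarith
    have hn4 : ‖dir (π / 4)‖ = Real.sqrt 2 / 2 := by
      rw [norm_dir_of_mem_octant ⟨by positivity, le_rfl⟩, Real.cos_pi_div_four]
    have hqπ : (B.q1 : ℝ) / 10 ^ 6 * ‖dir (π / 4)‖ ≤ π := by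
      rw [hn4]
      have := mul_le_mul hq4 hsqlt.le (by positivity) (by norm_num)
      linarith
    have hcomp : rayDispersion (π / 4, (B.q1 : ℝ) / 10 ^ 6) ≤ μ := by
      rw [rayDispersion_eq]
      simp only [Real.cos_pi_div_four, Real.sin_pi_div_four]
      have hx0 : 0 ≤ (B.q1 : ℝ) / 10 ^ 6 * (Real.sqrt 2 / 2) := by positivity
      have hx2 : ((B.q1 : ℝ) / 10 ^ 6 * (Real.sqrt 2 / 2)) ^ 2 = ((B.q1 * B.q1 : ℕ) : ℝ) / (2 * 10 ^ 12) := by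
        rw [mul_pow, hsq2, Nat.cast_mul]; ring
      have hT := fpCosLoTop_le (B.q1 * B.q1) hx0 hx2
      have h10' : -4 * ((fpCosLoTop (B.q1 * B.q1) : ℤ) : ℝ) * 10 ^ 6 ≤ (B.m1 : ℝ) * (87178291200 * 128 * 10 ^ 84) := by
        exact_mod_cast h10
      linarith only [hT, h10', hm1]
    have hge : (B.q1 : ℝ) / 10 ^ 6 ≤ bandFermiRadius μ (π / 4) :=
      le_bandFermiRadius_of_rayDispersion_le hμ₁ hμ₂ hq0 hqπ hcomp
    have hq1r : (B.q1 : ℝ) ≤ bandFermiRadius μ θ * 10 ^ 6 := by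
      rw [div_le_iff₀ (by norm_num : (0:ℝ) < 10 ^ 6)] at hge; linarith
    exact ⟨⟨hq1r, hq2r⟩, ⟨hc1r, hc2r⟩, hs2'⟩

end Sound

end Summit.HubbardSuperconductivity.HubbardSuperconductivity.Theorems.PerturbedFermiCurve
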